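import Literature.Claims.NS.VasquezCampos2024
import Literature.Claims.NS.ClayPeriodScalingBridge
import HarnessLib

/-!
# Solo salvage for claim C35 `VasquezCampos2024` (cell `ns-claims`, D-0090): the §2 reduction (Step 1),
# kernel-discharged

Claim skeleton: `Literature/Claims/NS/VasquezCampos2024.lean` (typist-8, p47xxxx); VERDICT (refuter-7,
2026-08-27): false lemma at Step 2 `GlueThreshold` / `CompositionRule` (§2 l.713 × Cor. 23; kill
`Theorems/SoloRefuteVasquezCampos2024.lean`). This file (seat `ns-claims-salvage-p2`, salvage lane of C35)
discharges Step 1: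

* `reduction_holds : Reduction` — §2 l.660–733 pp.4–5: if the Clay problem with viscosity `αν` and datum
  `u⁰(·/α)` is solvable then so is the one with viscosity `ν` and datum `u⁰`, via `u(x,t) = v(αx, αt)`.
  In the tree's vocabulary this is Leray's parabolic rescaling `v ↦ α v(α²t, αx)` (same viscosity;
  `ClayVariants.isNavierStokesSolution_nsRescale_zero`, here plus bounded energy `hasBoundedEnergy_nsRescale`)
  followed by the amplitude–time rescaling `w ↦ α⁻¹ w(α⁻¹ t)` that divides the viscosity by `α`
  (`ClayVariants.Solvable.of_viscosity`). TRUE classical symmetry bookkeeping (Leray 1934 §20; Tao 2013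
  Rem. 1.2); the claim's failure is in the NEXT step (the threshold is not invariant under this scaling).

Solo lane (`Theorems/SoloSalvage<Slug>.lean`, no item).

WHAT THIS IS NOT: not a claim about NS regularity or blow-up; not a claim about any author beyond the
typed locator.
-/

noncomputable section

open Set MeasureTheory
open scoped ENNReal

-- The mandated landing namespace repeats the summit name by design (D-0017).
set_option linter.dupNamespace false

namespace Summit.NavierStokesRegularity.NavierStokesRegularity.Theorems

namespace VasquezCampos2024

open Literature.Claims.NS.VasquezCampos2024 Literature.Claims.NS.ClayVariants Literature.Analysis
  Literature.Analysis.FluidPDE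

/-- Haar change of variables on `ℝ³` for lower integrals: `∫⁻ g(a • x) dx = |(a³)⁻¹| ∫⁻ g` for `a ≠ 0`
(Mathlib `Measure.map_addHaar_smul`). [folklore] -/
private theorem lintegral_comp_smul_R3 (g : R3 → ℝ≥0∞) {a : ℝ} (ha : a ≠ 0) :
    ∫⁻ x, g (a • x) = ENNReal.ofReal |(a ^ Module.finrank ℝ R3)⁻¹| * ∫⁻ x, g x := by
  calc ∫⁻ x, g (a • x) = ∫⁻ y, g y ∂(Measure.map (a • ·) volume) :=
        (lintegral_map_equiv g (Homeomorph.smul (isUnit_iff_ne_zero.2 ha).unit).toMeasurableEquiv).symm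
    _ = ENNReal.ofReal |(a ^ Module.finrank ℝ R3)⁻¹| * ∫⁻ x, g x := by
        rw [Measure.map_addHaar_smul volume ha, lintegral_smul_measure, smul_eq_mul]

/-- Bounded energy (Fefferman's (7)) is preserved by Leray's rescaling `v ↦ c v(c²t, cx)`, `c > 0`
(the bound is multiplied by `c² · c⁻³`). [cite: FeffermanClay2006, (7) p. 1] -/
theorem hasBoundedEnergy_nsRescale {v : ℝ → R3 → R3} (hE : FluidPDE.HasBoundedEnergy v) {c : ℝ}
    (hc : 0 < c) : FluidPDE.HasBoundedEnergy (nsRescale c v) := by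
  obtain ⟨C, hC, hCb⟩ := hE
  refine ⟨ENNReal.ofReal (c ^ 2) * (ENNReal.ofReal |(c ^ Module.finrank ℝ R3)⁻¹| * C),
    ENNReal.mul_lt_top ENNReal.ofReal_lt_top (ENNReal.mul_lt_top ENNReal.ofReal_lt_top hC),
    fun t ht => ?_⟩
  have h1 : (fun x => ‖nsRescale c v t x‖ₑ ^ 2) = fun x => ‖c • v (c ^ 2 * t) (c • x)‖ₑ ^ 2 := by
    funext x; rfl
  rw [h1, lintegral_enorm_sq_const_smul,
    lintegral_comp_smul_R3 (fun y => ‖v (c ^ 2 * t) y‖ₑ ^ 2) hc.ne']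
  gcongr
  exact hCb (c ^ 2 * t) (by positivity)

/-- **Step 1 (`Reduction`, §2 l.660–733 pp.4–5) HOLDS**: solvability of the Clay problem at viscosity `αν`
for the datum `u⁰(·/α)` gives solvability at viscosity `ν` for `u⁰` — Leray's parabolic rescaling by `α`
(datum becomes `α u⁰`, same viscosity, bounded energy kept) followed by the amplitude–time rescaling by
`α⁻¹` (datum `u⁰`, viscosity `ν`); the composite is the paper's `u(x,t) = v(αx, αt)`.
[cite: VasquezCampos2024, §2 l.660–733 pp.4–5] -/
theorem reduction_holds : Literature.Claims.NS.VasquezCampos2024.Reduction := by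
  intro ν α _hν hα u₀ _hu₀ hsol
  obtain ⟨v, q, hv, hq, hns, hE⟩ := hsol
  -- Leray rescaling by `c = α`
  obtain ⟨hns', hv', hq'⟩ := isNavierStokesSolution_nsRescale_zero hns hv hq hα
  have hdat : nsRescaleData α (fun x : R3 => u₀ (α⁻¹ • x)) = fun x => (α⁻¹)⁻¹ • u₀ x := by
    funext x
    simp [nsRescaleData, smul_smul, inv_mul_cancel₀ hα.ne']
  rw [hdat] at hns'
  have hsol' : clayR3.Solvable (α * ν) 0 (fun x => (α⁻¹)⁻¹ • u₀ x) :=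
    ⟨_, _, hv', hq', hns', hasBoundedEnergy_nsRescale hE hα⟩
  -- amplitude–time rescaling by `a = α⁻¹`
  have h2 := ClaySpec.Solvable.of_viscosity (S := clayR3) (μ := α * ν) (a := α⁻¹) (inv_pos.2 hα)
    (fun w _ hw => hasBoundedEnergy_timeRescale hw (inv_pos.2 hα)) (g := 0) hsol'
  have hvis : α⁻¹ * (α * ν) = ν := by field_simp
  have hforce : timeRescale α⁻¹ (α⁻¹ ^ 2) (0 : ℝ → R3 → R3) = 0 := by
    funext s x; simp [timeRescale]
  rw [hvis, hforce] at h2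
  exact h2

end VasquezCampos2024

end Summit.NavierStokesRegularity.NavierStokesRegularity.Theorems
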